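/-
Copyright (c) 2026 the pub-hodgecm-mathlib formalisation cell (harness21).  Prover seat hodgecm-mathlib-K2E2-p12 (g6): Track B «K2-LIT», ENGINE E1,
h413 = stmt-HodgeConjecture-24833; R8₂-sph ROAD T′, road (A) GELFAND, deal (128)(ii) of K2E1-plan (g7): THE ARCHIMEDEAN PAYER of the per-place letter (LOC) of ★ `K2E1HeckeCommuteGluingU`
— commuting ORBITAL operators (Gelfand's trick ★) ⇒ commuting HECKE sandwiches `P π(x) P`; print at `U(2,1)`.
-/
import Literature.RepresentationTheory.KonnoKonno2007.UnitaryTwoOneOrbitalCommute   -- ★ `commute_orbitalOp_uFormGroup_two_one` (+ ★ `CompactGroups.orbitalOp`, `apply_orbitalOp`, `adjoint_orbitalOp`)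
import Literature.NumberTheory.Automorphic.ClosedCompactDecomposition                  -- ★ `isMulRightInvariant_of_compactSpace`, `isInvInvariant_of_compactSpace`
import Mathlib.Analysis.InnerProductSpace.Projection.Basic
import HarnessLib

/-!
# K2·E1 — `K2E1HeckeCommuteOfOrbitalU` (deal (128)(ii), road (A) GELFAND, archimedean places): COMMUTING ORBITAL OPERATORS ⇒ COMMUTING HECKE SANDWICHES `P_K π(x) P_K`;
# hence the per-place letter (LOC) of ★ `K2E1HeckeCommuteGluingU` at a real place of signature `(2,1)` [Helgason Ch. IV §3 Thm. 3.1; Deitmar–Echterhoff 6.1.7, 7.3.1; Bump 2.4.2]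

Track B ∕ K2-LIT, crux h413 = `stmt-HodgeConjecture-24833`, route of record `HCCMUnconditional`; cell `hodgecm-mathlib`, squad K2, ENGINE E1 (R8₂-sph ROAD T′, road (A)
GELFAND: (A3) ★ p859707 ← GLUING ★ p859808 ← per-place letters (LOC); THIS FILE pays (LOC) at the archimedean places from ORBITAL commutativity).  THEOREMS ONLY (no `def`, no
`instance`, no notation, no `sorry`; default heartbeats); lane `--supports stmt-HodgeConjecture-24833 --as helper` (count-neutral).

THE BRIDGE (generic: `G` a topological group, `K` compact with probability Haar `μ`, `ι : K →* G` continuous, `π` unitary strongly continuous on a Hilbert space `H`, `O_x = ∫_K π(ιk·x·ιk⁻¹) dμ`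
the orbital operators of ★ `CompactGroups.GelfandTrickOrbitalOperators`, `P = P_K` the orthogonal projection onto the `ι(K)`-fixed vectors `Kfix`):
* §1 `sandwich_orbitalOp_eq`: **`P O_x P = P π(x) P`** for any `P` with `P π(ιk) = P = π(ιk) P` (the integrand `P π(ιk) π(x) π(ιk)⁻¹ P` is constant, `μ(K) = 1`);
* §2 `commute_starProjection_of_mem` (Hilbert lemma: `T(U) ⊆ U ∧ T†(U) ⊆ U ⇒ P_U T = T P_U`); `starProjection_comp_rep_eq`∕`rep_comp_starProjection_eq` (`P_K π(ιk) = P_K = π(ιk) P_K`);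
* §3 **`commute_sandwich_of_commute_orbitalOp`**: if the `O_x` pairwise commute then so do the `P_K π(x) P_K` — `O_x` commutes with `π(ιK)` ★ and `O_x† = O_{x⁻¹}` ★, so `O_x` commutes with
  `P_K`; then `(P O_x P)(P O_y P) = P O_x O_y P`.  This is EXACTLY the shape (LOC) `Commute (Pl v * ρ(φ_v x) * Pl v) (Pl v * ρ(φ_v y) * Pl v)` of ★ `K2E1HeckeCommuteGluingU` at a place
  `v` whose local group carries Gelfand's trick in the STRONG (Ad `K`-conjugacy) form ★ `commute_orbitalOp_of_antiHom`.
* §4 **`commute_sandwich_uFormGroup_two_one`** — THE PRINT AT `U(2,1)` (every real place of `U(Φ₃)`, `N = 3`): for EVERY unitary strongly continuous representation `σ` of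
  `U(2,1) = uFormGroup (Fin 2) β` and `P` the orthogonal projection onto the `U(2) × U(β)`-fixed vectors, the sandwiches `P σ(x) P` pairwise commute (★ `commute_orbitalOp_uFormGroup_two_one`,
  Haar probability measure on `K` built here; the conclusion is measure-free).  The `U(1,1)` print (`N = 2`) follows the same way from the `U(1,1)` transpose-conjugacy (next file).
HONEST LABEL: HC_CM is proved only modulo the 7 printed citations (2 remaining named inputs: hLiu418 = `stmt-HodgeConjecture-24832`, h413 = `stmt-HodgeConjecture-24833`) until rung 0
closes; this file asserts no named fact and closes no socket; count-neutral; unconditional.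

## References
* [Helgason2000] S. Helgason, *Groups and Geometric Analysis*, AMS (2000): Ch. IV §3, Thm. 3.1 (Gelfand's lemma).
* [DeitmarEchterhoff2014] A. Deitmar, S. Echterhoff, *Principles of Harmonic Analysis*, 2nd ed. (2014): Lemma 6.1.7, Lemma 7.3.1.
* [Bump1997] D. Bump, *Automorphic Forms and Representations* (1997): Thm. 2.4.2 (the sandwich computation `⟨π(φ)x, v⟩`, p. 517ff. of the proof), Thm. 4.6.1.
* [HarishChandra1953] Harish-Chandra, Trans. AMS 75 (1953): Thms. 4–6 (admissibility at `U(2,1)`, through ★ `UnitaryTwoOneOrbitalCommute`).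
-/

set_option autoImplicit false
set_option linter.dupNamespace false -- the mandated namespace repeats `HodgeConjecture.HodgeConjecture`

noncomputable section

open scoped InnerProductSpace
open MeasureTheory Measure ContRepresentation
open Literature.RepresentationTheory.CompactGroups Literature.RepresentationTheory.KonnoKonno2007 Literature.RepresentationTheory.KonnoKonno2007.RealDualPair
open Literature.RepresentationTheory.BorelWallach2000 Literature.NumberTheory.Automorphic

namespace Summit.HodgeConjecture.HodgeConjecture.Cruxes.H413.K2E1HeckeCommuteOfOrbitalU

/-! ## §1 `P O_x P = P π(x) P` -/

section Sandwich

variable {G : Type*} [Group G] [TopologicalSpace G] [IsTopologicalGroup G]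
variable {K : Type*} [Group K] [TopologicalSpace K] [IsTopologicalGroup K] [CompactSpace K] [MeasurableSpace K] [BorelSpace K]
variable {μ : Measure K} [IsProbabilityMeasure μ] {ι : K →* G}
variable {H : Type*} [NormedAddCommGroup H] [InnerProductSpace ℂ H] [CompleteSpace H] {π : ContRepresentation ℂ G H}
variable {hι : Continuous ι} {hπ : π.IsStronglyContinuous} {hU : π.IsUnitary}

omit [IsTopologicalGroup K] in
/-- **`P O_x P = P π(x) P`** for every bounded `P` absorbing `π(ιK)` on both sides (`P π(ιk) = P = π(ιk) P`, e.g. `P = P_K`): the Bochner integrand `P π(ιk) π(x) π(ιk)⁻¹ P v` is the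
constant `P π(x) P v` and `μ(K) = 1`. [cite: Bump1997, Thm. 2.4.2] [cite: Helgason2000, Ch. IV §3 Thm. 3.1] -/
theorem sandwich_orbitalOp_eq (P : H →L[ℂ] H) (hPk : ∀ (k : K) (v : H), P (π (ι k) v) = P v) (hkP : ∀ (k : K) (v : H), π (ι k) (P v) = P v) (x : G) :
    P * orbitalOp μ ι π hι hπ hU x * P = P * π x * P := by
  refine ContinuousLinearMap.ext fun v => ?_
  simp only [mul_apply_eq_comp]
  rw [orbitalOp_apply, ← P.integral_comp_comm (integrable_repConjOrbit μ ι π hι hπ x (P v))]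
  have hconst : (fun k : K => P (π (ι k * x * (ι k)⁻¹) (P v))) = fun _ => P (π x (P v)) := by
    funext k
    rw [map_mul, map_mul, mul_apply_eq_comp, mul_apply_eq_comp, ← map_inv, hkP, hPk]
  rw [hconst, integral_const, probReal_univ, one_smul]

end Sandwich

/-! ## §2 Hilbert-space lemmas: an operator preserving `U` together with its adjoint commutes with `P_U`; `P_K` absorbs `π(ιK)` -/

section Hilbert

variable {E : Type*} [NormedAddCommGroup E] [InnerProductSpace ℂ E] [CompleteSpace E]

/-- If `T(U) ⊆ U` and `T†(U) ⊆ U` then `P_U T = T P_U` (`T` maps `Uᗮ` into `Uᗮ` as well). [cite: DeitmarEchterhoff2014, Lemma 7.3.1] -/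
theorem commute_starProjection_of_mem (U : Submodule ℂ E) [U.HasOrthogonalProjection] (T : E →L[ℂ] E)
    (hT : ∀ u ∈ U, T u ∈ U) (hTadj : ∀ u ∈ U, ContinuousLinearMap.adjoint T u ∈ U) : Commute U.starProjection T := by
  refine ContinuousLinearMap.ext fun v => ?_
  change U.starProjection (T v) = T (U.starProjection v)
  have hsplit : T v = T (U.starProjection v) + T (v - U.starProjection v) := by rw [← map_add, add_sub_cancel]
  have horth : T (v - U.starProjection v) ∈ Uᗮ := by
    rw [Submodule.mem_orthogonal]
    intro u hu
    rw [← ContinuousLinearMap.adjoint_inner_left]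
    exact Submodule.inner_right_of_mem_orthogonal (hTadj u hu) (U.sub_starProjection_mem_orthogonal v)
  rw [hsplit, map_add, Submodule.starProjection_eq_self_iff.2 (hT _ (U.starProjection_apply_mem v)),
    (Submodule.starProjection_apply_eq_zero_iff (K := U)).2 horth, add_zero]

variable {G : Type*} [Group G] {π : ContRepresentation ℂ G E}

omit [CompleteSpace E] in
/-- `π(k) P_K = P_K` on vectors: `P_K v` is `K`-fixed. [cite: DeitmarEchterhoff2014, Lemma 7.3.1] -/
theorem rep_apply_starProjection_eq {S : Type*} [SetLike S G] (K : S) (Kfix : Submodule ℂ E) (hKfix : ∀ v : E, v ∈ Kfix ↔ ∀ k ∈ K, π k v = v)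
    [Kfix.HasOrthogonalProjection] {k : G} (hk : k ∈ K) (v : E) : π k (Kfix.starProjection v) = Kfix.starProjection v :=
  (hKfix _).1 (Kfix.starProjection_apply_mem v) k hk

/-- `P_K π(k) = P_K` on vectors for UNITARY `π` and `K` closed under inverses: `π(k) v - v ⟂ Kfix` (`⟪u, π(k)v⟫ = ⟪π(k⁻¹)u, v⟫ = ⟪u, v⟫`). [cite: DeitmarEchterhoff2014, Lemma 7.3.1] -/
theorem starProjection_rep_apply_eq (hu : π.IsUnitary) (K : Subgroup G) (Kfix : Submodule ℂ E) (hKfix : ∀ v : E, v ∈ Kfix ↔ ∀ k ∈ K, π k v = v)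
    [Kfix.HasOrthogonalProjection] {k : G} (hk : k ∈ K) (v : E) : Kfix.starProjection (π k v) = Kfix.starProjection v := by
  rw [← sub_eq_zero, ← map_sub, Submodule.starProjection_apply_eq_zero_iff, Submodule.mem_orthogonal]
  intro u hu'
  rw [inner_sub_right, ← ContinuousLinearMap.adjoint_inner_left, hu.adjoint_apply, (hKfix u).1 hu' k⁻¹ (K.inv_mem hk), sub_self]

end Hilbert

/-! ## §3 Commuting orbital operators ⇒ commuting Hecke sandwiches `P_K π(x) P_K` (the (LOC) shape of ★ `K2E1HeckeCommuteGluingU`) -/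

section Bridge

variable {G : Type*} [Group G] [TopologicalSpace G] [IsTopologicalGroup G]
variable {K : Type*} [Group K] [TopologicalSpace K] [IsTopologicalGroup K] [CompactSpace K] [MeasurableSpace K] [BorelSpace K]
variable (μ : Measure K) [IsProbabilityMeasure μ] [μ.IsMulLeftInvariant] (ι : K →* G)
variable {H : Type*} [NormedAddCommGroup H] [InnerProductSpace ℂ H] [CompleteSpace H] (π : ContRepresentation ℂ G H)
variable (hι : Continuous ι) (hπ : π.IsStronglyContinuous) (hU : π.IsUnitary)

/-- In a monoid: `P` idempotent commuting with `A` and `B`, and `A B = B A` ⇒ the sandwiches `P A P`, `P B P` commute. [cite: Helgason2000, Ch. IV §3 Thm. 3.1] -/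
theorem commute_sandwich_of_commute {M : Type*} [Monoid M] {P A B : M} (hP : P * P = P) (hPA : Commute P A) (hPB : Commute P B) (hAB : Commute A B) :
    Commute (P * A * P) (P * B * P) := by
  have h1 : P * A * P * (P * B * P) = P * (A * B) * P := by
    calc P * A * P * (P * B * P) = P * A * (P * P) * B * P := by simp only [mul_assoc]
      _ = P * A * P * B * P := by rw [hP]
      _ = P * A * (P * B) * P := by simp only [mul_assoc]
      _ = P * A * (B * P) * P := by rw [hPB.eq]
      _ = P * (A * B) * (P * P) := by simp only [mul_assoc]
      _ = P * (A * B) * P := by rw [hP]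
  have h2 : P * B * P * (P * A * P) = P * (B * A) * P := by
    calc P * B * P * (P * A * P) = P * B * (P * P) * A * P := by simp only [mul_assoc]
      _ = P * B * P * A * P := by rw [hP]
      _ = P * B * (P * A) * P := by simp only [mul_assoc]
      _ = P * B * (A * P) * P := by rw [hPA.eq]
      _ = P * (B * A) * (P * P) := by simp only [mul_assoc]
      _ = P * (B * A) * P := by rw [hP]
  change P * A * P * (P * B * P) = P * B * P * (P * A * P)
  rw [h1, h2, hAB.eq]

/-- **COMMUTING ORBITAL OPERATORS ⇒ COMMUTING HECKE SANDWICHES.**  `π` unitary strongly continuous, `K` compact with left-invariant probability measure `μ`, `ι : K →* G` continuous, `Kfix` the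
`ι(K)`-fixed vectors and `P = Kfix.starProjection`.  If the orbital operators `O_x = ∫_K π(ιk·x·ιk⁻¹) dμ` pairwise commute (Gelfand's trick ★ `commute_orbitalOp_of_antiHom`), then
**`∀ x y, Commute (P * π x * P) (P * π y * P)`** — the per-place letter (LOC) of ★ `K2E1HeckeCommuteGluingU` for the representation `π` of the local group.
[cite: Helgason2000, Ch. IV §3 Thm. 3.1] [cite: DeitmarEchterhoff2014, Lemma 6.1.7 and Lemma 7.3.1] [cite: Bump1997, Thm. 2.4.2] -/
theorem commute_sandwich_of_commute_orbitalOp (Kfix : Submodule ℂ H) (hKfix : ∀ v : H, v ∈ Kfix ↔ ∀ k ∈ ι.range, π k v = v) [Kfix.HasOrthogonalProjection]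
    (hcomm : ∀ x y : G, Commute (orbitalOp μ ι π hι hπ hU x) (orbitalOp μ ι π hι hπ hU y)) (x y : G) :
    Commute (Kfix.starProjection * π x * Kfix.starProjection) (Kfix.starProjection * π y * Kfix.starProjection) := by
  set P : H →L[ℂ] H := Kfix.starProjection with hP
  have hkP : ∀ (k : K) (v : H), π (ι k) (P v) = P v := fun k v => rep_apply_starProjection_eq ι.range Kfix hKfix ⟨k, rfl⟩ v
  have hPk : ∀ (k : K) (v : H), P (π (ι k) v) = P v := fun k v => starProjection_rep_apply_eq hU ι.range Kfix hKfix ⟨k, rfl⟩ v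
  -- `O_z` commutes with `P`
  have hPO : ∀ z : G, Commute P (orbitalOp μ ι π hι hπ hU z) := by
    intro z
    have hmem : ∀ z : G, ∀ u ∈ Kfix, orbitalOp μ ι π hι hπ hU z u ∈ Kfix := by
      intro z u hu'
      rw [hKfix]
      rintro _ ⟨k, rfl⟩
      rw [apply_orbitalOp, (hKfix u).1 hu' (ι k) ⟨k, rfl⟩]
    refine commute_starProjection_of_mem Kfix _ (hmem z) fun u hu' => ?_
    rw [adjoint_orbitalOp]
    exact hmem z⁻¹ u hu'
  rw [← sandwich_orbitalOp_eq (μ := μ) (hι := hι) (hπ := hπ) (hU := hU) P hPk hkP x,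
    ← sandwich_orbitalOp_eq (μ := μ) (hι := hι) (hπ := hπ) (hU := hU) P hPk hkP y]
  exact commute_sandwich_of_commute (Kfix.isIdempotentElem_starProjection.eq) (hPO x) (hPO y) (hcomm x y)

end Bridge

/-! ## §4 THE PRINT AT `U(2,1)`: the Hecke sandwiches of every unitary representation of `U(2,1)` commute ((LOC) at a real place of `U(Φ₃)`) -/

section UTwoOne

variable {β : Type*} [Fintype β] [DecidableEq β] [Unique β]
  {E : Type*} [NormedAddCommGroup E] [InnerProductSpace ℂ E] [CompleteSpace E]

/-- **(LOC) AT `U(2,1)`.**  For every unitary strongly continuous representation `σ` of (the carrier of) `U(2,1) = uFormGroup (Fin 2) β` (`|β| = 1`) on a Hilbert space, `Kfix` the vectors fixed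
by the maximal compact `K = U(2) × U(β)` (embedded by `ιK = incl ∘ upqMaximalCompactEquiv⁻¹` ★) and `P = Kfix.starProjection`: **`∀ x y, Commute (P * σ x * P) (P * σ y * P)`** — from ★
`commute_orbitalOp_uFormGroup_two_one` (Gelfand's trick for the transpose; the Haar probability measure of `K` is built here and does not appear in the statement).
[cite: Helgason2000, Ch. IV §3 Thm. 3.1] [cite: HarishChandra1953, Thms. 4–6] [cite: Bump1997, Thm. 2.4.2] -/
theorem commute_sandwich_uFormGroup_two_one (σ : ContRepresentation ℂ ↥(uFormGroup (Fin 2) β).carrier E) (hc : σ.IsStronglyContinuous) (hU : σ.IsUnitary)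
    (Kfix : Submodule ℂ E)
    (hKfix : ∀ v : E, v ∈ Kfix ↔ ∀ k ∈ ((Subgroup.inclusion (uFormGroup (Fin 2) β).maximalCompact_le_carrier).comp
      (upqMaximalCompactEquiv (α := Fin 2) (β := β)).symm.toMulEquiv.toMonoidHom).range, σ k v = v)
    [Kfix.HasOrthogonalProjection] (x y : ↥(uFormGroup (Fin 2) β).carrier) :
    Commute (Kfix.starProjection * σ x * Kfix.starProjection) (Kfix.starProjection * σ y * Kfix.starProjection) := by
  classical
  -- the compact group `K₀ = U(2) × U(β)`, its Haar probability measure, and its continuous embedding `ιK`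
  haveI : CompactSpace ↥(Matrix.unitaryGroup (Fin 2) ℂ) := isCompact_iff_compactSpace.mp Matrix.isCompact_unitaryGroup
  haveI : CompactSpace ↥(Matrix.unitaryGroup β ℂ) := isCompact_iff_compactSpace.mp Matrix.isCompact_unitaryGroup
  haveI : SecondCountableTopology (Matrix (Fin 2) (Fin 2) ℂ) := inferInstanceAs (SecondCountableTopology (Fin 2 → Fin 2 → ℂ))
  haveI : SecondCountableTopology (Matrix β β ℂ) := inferInstanceAs (SecondCountableTopology (β → β → ℂ))
  haveI : SecondCountableTopology ↥(Matrix.unitaryGroup (Fin 2) ℂ) := TopologicalSpace.Subtype.secondCountableTopology _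
  haveI : SecondCountableTopology ↥(Matrix.unitaryGroup β ℂ) := TopologicalSpace.Subtype.secondCountableTopology _
  haveI : SecondCountableTopology (KV (Fin 2) β) := inferInstance
  letI : MeasurableSpace (KV (Fin 2) β) := borel _
  haveI : BorelSpace (KV (Fin 2) β) := ⟨rfl⟩
  set μ : Measure (KV (Fin 2) β) := haarMeasure ⊤ with hμ
  haveI : IsProbabilityMeasure μ := ⟨by rw [hμ, ← TopologicalSpace.PositiveCompacts.coe_top]; exact haarMeasure_self⟩
  haveI : T2Space (KV (Fin 2) β) := inferInstance
  haveI : IsHaarMeasure μ := by rw [hμ]; infer_instance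
  haveI : μ.IsMulRightInvariant := isMulRightInvariant_of_compactSpace μ
  haveI : μ.IsInvInvariant := isInvInvariant_of_compactSpace μ
  set ιK : KV (Fin 2) β →* ↥(uFormGroup (Fin 2) β).carrier :=
    (Subgroup.inclusion (uFormGroup (Fin 2) β).maximalCompact_le_carrier).comp
      (upqMaximalCompactEquiv (α := Fin 2) (β := β)).symm.toMulEquiv.toMonoidHom with hιK
  have hι : Continuous ιK :=
    (Continuous.subtype_mk continuous_subtype_val _).comp (upqMaximalCompactEquiv (α := Fin 2) (β := β)).symm.continuous
  exact commute_sandwich_of_commute_orbitalOp μ ιK σ hι hc hU Kfix hKfix (commute_orbitalOp_uFormGroup_two_one (β := β) μ σ hc hU hι) x y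

end UTwoOne

end Summit.HodgeConjecture.HodgeConjecture.Cruxes.H413.K2E1HeckeCommuteOfOrbitalU

end
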